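import Summits.AtomisticToContinuum.HydrodynamicLimit.Theorems.InformationPercolationEngineChaosClosesEulerReductionPathwiseC
import Summits.AtomisticToContinuum.HydrodynamicLimit.Theorems.InformationPercolationEngineChaosClosesEulerReductionFrameA
import Summits.AtomisticToContinuum.HydrodynamicLimit.Theorems.InformationPercolationEngineChaosClosesEulerReductionCoincidence
import HarnessLib

/-!
# Kinetic reduction (crux `ChaosClosesEuler`, stmt-AtomisticToContinuum-15141, line `Sketch`,
# stub `stub_kineticReduction`) — helper: the union bound at one `N`, cold-clamped shell with `C¹` tests (v8)

WHAT. `reduction_events_cold`: the analogue of `reduction_events` (helper `ReductionFrameA`) for the corrected shell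
(skeleton v8: `E ≥ 0` hypothesised, the entropy weight of EXACTLY COLD cone states is the lower cut-off `a₁`, (H1)
over `C¹` space–time tests). At a fixed particle number and mollification radius, with every tolerance fixed: if the
eleven bad events of `reduction_events` (energy level, density cap, collision tail, collision-rate deviations on the
grid windows and on the whole horizon, weak stress isotropy, collisional pressure and clamped local second law
deviations on the grids, the three initial deviations) have probability `≤ δ₁` each, then the deviation event of the
time-averaged `L¹` distance has probability `≤ 11 δ₁ ≤ δ'`: the law being absolutely continuous with respect to the
Liouville measure, the complement of the good set and the coincidence event (two particles sharing a velocity at a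
rational time, `measure_coincSet_eq_zero` of helper `ReductionCoincidence`) form a null event
(`stub_reductionFrameD`), and outside all twelve events the deterministic core `reduction_pathwise_coldC1` (helper
`ReductionPathwiseC`) applies, velocities being pairwise distinct at every time (`vel_ne_of_not_mem_coincSet`).

WHY (for the thresholds step). Compared with `reduction_events` the statement has: `hf` (continuity of the excess free
energy, after `hχ`); the v8 text of the shell hypothesis `hSH`; the thinness level `lam` of cold cones at this `N`
(`hlam`, `hlam1`, `hκ`, after `hδ`); the cold summand of the entropy smallness condition `hS3`; and
`hP : P ≪ liouville …` in place of `P Φ.goodᶜ = 0`. All other hypotheses, their order, the events and the conclusion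
are verbatim those of `reduction_events`.

No named fact is invoked.
-/

noncomputable section

namespace Summit.AtomisticToContinuum.HydrodynamicLimit.Theorems.ChaosClosesEulerReduction

open scoped BigOperators Topology Classical MeasureTheory InnerProductSpace ENNReal
open Filter Set MeasureTheory Function
open Literature.MathematicalPhysics.KineticTheory
open Literature.Analysis.FluidPDE
open Literature.Analysis.FunctionSpaces
open Summit.AtomisticToContinuum.HydrodynamicLimit.Theorems.LocalSecondLawNegative
open Summit.AtomisticToContinuum.HydrodynamicLimit.Theorems.LocalSecondLawLedger
open Summit.AtomisticToContinuum.HydrodynamicLimit.Theorems.LocalSecondLawLedger.L (Mmom)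

variable {N : ℕ}

/-! ## §1 The null event -/

/-- **Registered sub-goal `stub_reductionFrameD` (helper of `stub_kineticReduction`): the union of two null events
is null** — the null event of the union bound is the complement of the good set together with the coincidence event.
[folklore] -/
theorem stub_reductionFrameD : ∀ {Ω : Type} [MeasurableSpace Ω] (P : MeasureTheory.Measure Ω) {A B : Set Ω}, P A = 0 → P B = 0 → P (A ∪ B) = 0 :=
  fun _ _ _ hA hB => measure_union_null hA hB

/-- **The null event of the cold union bound.** For a law absolutely continuous with respect to the Liouville measure,
the complement of the good set together with the coincidence event is null. [folklore] -/
theorem measure_compl_good_union_coincSet_eq_zero {ε : ℝ} (Φ : HardSphereFlow (Torus.geometry (Fin 3)) ε (N + 1))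
    {P : Measure (Phase N)} (hP : P ≪ liouville (Torus.geometry (Fin 3)) (N + 1) ε) :
    P (Φ.goodᶜ ∪ ⋃ q : ℚ, ⋃ i : Fin (N + 1), ⋃ j : Fin (N + 1),
      {z : Phase N | i ≠ j ∧ (Φ.flow q z i).2 = (Φ.flow q z j).2}) = 0 :=
  stub_reductionFrameD P (hP Φ.measure_compl_good) (measure_coincSet_eq_zero Φ hP)

/-! ## §2 The union bound at one `N` -/

set_option maxHeartbeats 3200000 in
/-- **THE UNION BOUND AT ONE `N`, COLD-CLAMPED SHELL WITH `C¹` TESTS (v8).** See the module docstring. [folklore] -/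
theorem reduction_events_cold {σ : ℝ} (hσ : 0 < σ) (hσ2 : σ < 2⁻¹)
    (Φ : HardSphereFlow (Torus.geometry (Fin 3)) (hsDiameter σ N) (N + 1)) (P : Measure (Phase N))
    {r : ℝ} (hr : 0 < r) (hr2 : r < 1 / 2)
    {T : ℝ} {ρ θ : ℝ → T3 → ℝ} {u : ℝ → T3 → V3} (hE : IsHardSphereEulerSolution σ T ρ u θ)
    {t Δ e : ℝ} {m : ℕ} (ht0 : 0 ≤ t) (hΔ : 0 < Δ) (he : 0 < e) (hT : t + (m + 1 : ℕ) * Δ + e < T)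
    -- the shell at this `σ`, horizon `t + (m+1)Δ`, window `Δ`, defect `δ` (v8 text; NEW: `hf`)
    {η₁ a₁ b₁ ε' δ : ℝ} {χe f : ℝ → ℝ} (hχ : ContinuousOn χe (Ioi 0)) (hf : ContinuousOn f (Ioi 0))
    {B : ℝ} (hB0 : 0 ≤ B) (hB : ∀ a, 0 < a → |χe a| ≤ B)
    (hband : ∀ a, 0 < a → a * σ ^ 3 ≤ η₁ → χe a = hsCompressibility (a * σ ^ 3))
    (hfband : ∀ a, 0 < a → a * σ ^ 3 ≤ η₁ → f a = hsExcessFreeEnergy (a * σ ^ 3))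
    (hFc : ContinuousOn (fun c => hsExcessFreeEnergy (min c η₁) + deriv hsExcessFreeEnergy η₁ * max (c - η₁) 0) (Ici 0))
    (hSH : ∀ V : ℝ → T3 → ℝ × V3 × ℝ, Measurable (Function.uncurry V) →
      (∃ C : ℝ, ∀ s x, |(V s x).1| ≤ C ∧ ‖(V s x).2.1‖ ≤ C ∧ |(V s x).2.2| ≤ C) →
      (∀ s x, 0 ≤ (V s x).1) → (∀ s x, 0 ≤ (V s x).2.2) →
      (∀ s x, ‖(V s x).2.1‖ ^ 2 ≤ 2 * (V s x).1 * (V s x).2.2) →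
      let θo : ℝ × V3 × ℝ → ℝ := fun U => 2 / 3 * (U.2.2 / U.1 - ‖U.2.1‖ ^ 2 / (2 * U.1 ^ 2))
      let pV : ℝ × V3 × ℝ → ℝ := fun U => U.1 * θo U * χe U.1
      let Zs : ℝ × V3 × ℝ → ℝ := fun U => if 0 < θo U then max a₁ (min (3 / 2 * Real.log (θo U) - Real.log U.1 - f U.1) b₁) else a₁
      let Etot : ℝ → T3 → ℝ := fun s x => totalEnergyDensity (ρ s x) (u s x) (θ s x)
      let cut : ℝ → ℝ → ℝ := fun τ₀ s => Real.smoothTransition ((τ₀ + Δ - s) / Δ)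
      (∀ φ : ℝ → T3 → ℝ, ContDiff ℝ 1 (Torus.stLift φ) → ∀ τ ∈ Set.Icc 0 (t + (m + 1 : ℕ) * Δ), (∫ x, φ τ x * (V τ x).1) - ∫ x, φ 0 x * (V 0 x).1 = ∫ s in Set.Icc 0 τ, ∫ x, (deriv (fun s' => φ s' x) s * (V s x).1 + ∑ k : Fin 3, (V s x).2.1 k * Torus.partialDeriv k (φ s) x)) →
      (∀ τ ∈ Set.Icc 0 (t + (m + 1 : ℕ) * Δ), |(∫ x, ⟪u τ x, (V τ x).2.1⟫_ℝ) - (∫ x, ⟪u 0 x, (V 0 x).2.1⟫_ℝ) - ∫ s in Set.Icc 0 τ, ∫ x, (⟪Torus.timeDerivWithin (Set.Ico 0 T) u s x, (V s x).2.1⟫_ℝ + ∑ i : Fin 3, ∑ j : Fin 3, Torus.partialDeriv j (fun y => u s y i) x * ((V s x).2.1 i * (V s x).2.1 j / (V s x).1 + if i = j then pV (V s x) else 0))| ≤ δ) →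
      (∀ τ₀ ∈ Set.Icc 0 (t + (m + 1 : ℕ) * Δ - Δ), (∫ s in Set.Icc 0 (t + (m + 1 : ℕ) * Δ), ∫ x, ((V s x).1 * Zs (V s x) * Torus.timeDerivWithin (Set.Ico 0 T) (fun s' y => θ s' y * cut τ₀ s') s x + Zs (V s x) * ⟪(V s x).2.1, Torus.gradient (fun y => θ s y * cut τ₀ s) x⟫_ℝ)) + ∫ x, (V 0 x).1 * Zs (V 0 x) * (θ 0 x * cut τ₀ 0) ≤ δ) →
      (∀ τ ∈ Set.Icc 0 (t + (m + 1 : ℕ) * Δ), ∫ x, (V τ x).2.2 ≤ (∫ x, (V 0 x).2.2) + δ) →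
      (∀ x, |(V 0 x).1 - ρ 0 x| ≤ δ ∧ ‖(V 0 x).2.1 - ρ 0 x • u 0 x‖ ≤ δ ∧ |(V 0 x).2.2 - Etot 0 x| ≤ δ) →
      ∀ τ₀ ∈ Set.Icc 0 (t + (m + 1 : ℕ) * Δ - Δ), ∫ s in Set.Icc τ₀ (τ₀ + Δ), ∫ x, (|(V s x).1 - ρ s x| + ‖(V s x).2.1 - ρ s x • u s x‖ + |(V s x).2.2 - Etot s x|) ≤ ε' * Δ)
    (hδ : 0 ≤ δ)
    -- NEW: the thinness level of cold cones at this `N`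
    {lam : ℝ} (hlam : 0 < lam) (hlam1 : lam ≤ 1) (hκ : ((N + 1 : ℕ) : ℝ)⁻¹ * (3 / (Real.pi * r ^ 3)) ≤ lam ^ 2)
    -- guard, cap, cut-off levels
    {η₀g ηcap ηg ηg2 : ℝ} (hη₀g0 : 0 ≤ η₀g) (hguard : ∀ s ∈ Ico 0 T, ∀ x, ρ s x * σ ^ 3 < η₀g) (hcap0 : 0 ≤ ηcap)
    (hη₁cap : η₀g + ηcap ≤ η₁) (hg12 : ηg < ηg2) (hη₀gg : η₀g ≤ ηg / 2) (hcapg : ηcap ≤ ηg / 2)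
    {KE : ℝ} (hKE0 : 0 ≤ KE) {Lv η₂ : ℝ} {CY : ℝ} (hCY0 : 0 ≤ CY) (hCY : ∀ a ∈ Set.Icc 0 ηg2, |deriv hsExcessFreeEnergy a| ≤ CY)
    {n : ℕ} (hn : 1 ≤ n) (hne : (t + (m + 1 : ℕ) * Δ) / n ≤ e) {η₃ : ℝ}
    -- the classical velocity: bounds, shift moduli, space modulus of the gradient
    {Cu : ℝ} (hCu : 0 ≤ Cu) (hut : ∀ s ∈ Icc 0 (t + (m + 1 : ℕ) * Δ + e), ∀ x, ‖Torus.timeDerivWithin (Ico 0 T) u s x‖ ≤ Cu)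
    (hD : ∀ s ∈ Icc 0 (t + (m + 1 : ℕ) * Δ + e), ∀ x, ∀ i j : Fin 3, |Torus.partialDeriv j (fun y => u s y i) x| ≤ Cu)
    {ω : ℝ} (hω : 0 ≤ ω) (hωu : ∀ s ∈ Icc 0 (t + (m + 1 : ℕ) * Δ), ∀ x, ‖u (s + e) x - u s x‖ ≤ ω)
    (hωt : ∀ s ∈ Icc 0 (t + (m + 1 : ℕ) * Δ), ∀ x,
      ‖Torus.timeDerivWithin (Ico 0 T) u (s + e) x - Torus.timeDerivWithin (Ico 0 T) u s x‖ ≤ ω)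
    (hωD : ∀ s ∈ Icc 0 (t + (m + 1 : ℕ) * Δ), ∀ x, ∀ i j : Fin 3,
      |Torus.partialDeriv j (fun y => u (s + e) y i) x - Torus.partialDeriv j (fun y => u s y i) x| ≤ ω)
    {ωx : ℝ} (hωx0 : 0 ≤ ωx) (hωx : ∀ s ∈ Icc 0 (t + (m + 1 : ℕ) * Δ), ∀ x y : T3, Torus.euclidDist x y < r + hsDiameter σ N →
      ∀ i j : Fin 3, |Torus.partialDeriv j (fun y => u (s + e) y i) x - Torus.partialDeriv j (fun y' => u (s + e) y' i) y| ≤ ωx)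
    (hθ : Torus.IsSmoothSpaceTimeOn (Ico 0 T) θ)
    {Cθ : ℝ} (hCθ : 0 ≤ Cθ) (hθb : ∀ s ∈ Icc 0 (t + (m + 1 : ℕ) * Δ + e), ∀ x, |θ s x| ≤ Cθ)
    (hθt : ∀ s ∈ Icc 0 (t + (m + 1 : ℕ) * Δ + e), ∀ x, |Torus.timeDerivWithin (Ico 0 T) θ s x| ≤ Cθ)
    (hθx : ∀ s ∈ Icc 0 (t + (m + 1 : ℕ) * Δ + e), ∀ x, ‖Torus.gradient (θ s) x‖ ≤ Cθ)
    (hωθ : ∀ s ∈ Icc 0 (t + (m + 1 : ℕ) * Δ), ∀ x, |θ (s + e) x - θ s x| ≤ ω)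
    (hωθt : ∀ s ∈ Icc 0 (t + (m + 1 : ℕ) * Δ), ∀ x,
      |Torus.timeDerivWithin (Ico 0 T) θ (s + e) x - Torus.timeDerivWithin (Ico 0 T) θ s x| ≤ ω)
    (hωθx : ∀ s ∈ Icc 0 (t + (m + 1 : ℕ) * Δ), ∀ x, ‖Torus.gradient (θ (s + e)) x - Torus.gradient (θ s) x‖ ≤ ω)
    {C : ℝ} (hC1 : ∀ x, |deriv Real.smoothTransition x| ≤ C) (hC2 : ∀ x, |deriv (deriv Real.smoothTransition) x| ≤ C)
    {n' : ℕ} (hn' : 1 ≤ n') {ηW ηP ηL : ℝ}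
    -- the two smallness conditions (NEW: the cold summand of the entropy condition)
    (hS2 : ηW + ηP / 2 + 3 / 2 * Cu * hsDiameter σ N * (2 * (N + 1 : ℝ)⁻¹ + 8 * KE) +
        3 / 2 * ωx * ((1 + max Lv 0) * (η₃ + σ ^ 3 * (3 * (t + (m + 1 : ℕ) * Δ) * (3 / (2 * Real.pi) * CY) *
          (2 * Real.pi * (η₀g / σ ^ 3 + ηcap) * (1 / 2 + KE)))) + η₂) +
        (t + (m + 1 : ℕ) * Δ) / n * ((60 * Cu + 2 * Cu * (1 + B)) * KE) +
        3 / 2 * Cu * ((1 + max Lv 0) * (η₃ + σ ^ 3 * (3 * ((t + (m + 1 : ℕ) * Δ) / n) * (3 / (2 * Real.pi) * CY) *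
          (2 * Real.pi * (η₀g / σ ^ 3 + ηcap) * (1 / 2 + KE)))) + η₂) +
        ω * ((1 + 2 * KE) + (t + (m + 1 : ℕ) * Δ) * ((7 + 2 * B) * KE + 1 / 2)) ≤ δ)
    (hS3 : ηL + ((t + (m + 1 : ℕ) * Δ) * (max |a₁| |b₁| * (Cθ * (C / Δ * ((t + (m + 1 : ℕ) * Δ - Δ) / n'))) * KE +
          (max |a₁| |b₁| * (Cθ * (C / Δ * ((t + (m + 1 : ℕ) * Δ - Δ) / n')) + Cθ * (C / Δ ^ 2 * ((t + (m + 1 : ℕ) * Δ - Δ) / n'))) +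
            max |a₁| |b₁| * (Cθ * (C / Δ * ((t + (m + 1 : ℕ) * Δ - Δ) / n'))) / 2)) +
        max |a₁| |b₁| * Cθ * (C / Δ * ((t + (m + 1 : ℕ) * Δ - Δ) / n'))) +
      ((t + (m + 1 : ℕ) * Δ) * (max |a₁| |b₁| * ω * KE + (max |a₁| |b₁| * (ω + ω * (C / Δ)) + max |a₁| |b₁| * ω / 2)) +
        max |a₁| |b₁| * ω) +
      (t + (m + 1 : ℕ) * Δ - 0) * (2 * max |a₁| |b₁| * lam * ((Cθ * 1 + Cθ * (C / Δ)) + Cθ / 2) +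
        2 * max |a₁| |b₁| * lam * Cθ * KE + 0) ≤ δ)
    {δ₁ δ' thr : ℝ} (hδ₁ : 0 ≤ δ₁) (hδ' : 11 * δ₁ ≤ δ') (hthr : ε' * ((m + 1 : ℕ) * Δ) < thr)
    -- NEW: the law is absolutely continuous with respect to the Liouville measure (in place of `P Φ.goodᶜ = 0`)
    (hP : P ≪ liouville (Torus.geometry (Fin 3)) (N + 1) (hsDiameter σ N))
    -- the eleven bad events
    (evE : P {z | KE < ((N : ℝ) + 1)⁻¹ * configEnergy (Φ.flow 0 z)} ≤ ENNReal.ofReal δ₁)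
    (evCap : P {z | ∃ s ∈ Set.Icc 0 (t + (m + 1 : ℕ) * Δ + e), ∃ x : T3, ρ s x + ηcap < rhoC r (Φ.flow s z) x} ≤ ENNReal.ofReal δ₁)
    (evTail : P {z | η₂ < hsDiameter σ N / ((N : ℝ) + 1) *
      (∑ᶠ (s : ℝ) (_ : s ∈ collisionTimes (Torus.geometry (Fin 3)) (hsDiameter σ N) (fun s => Φ.flow s z) ∩
        Set.Icc 0 (t + (m + 1 : ℕ) * Δ + e)), ∑ i : Fin (N + 1), ∑ j : Fin (N + 1),
        (if i ≠ j ∧ ‖(Torus.geometry (Fin 3)).sepVec (Φ.flow s z i).1 (Φ.flow s z j).1‖ = hsDiameter σ N then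
          (if Lv < ‖(Φ.flow s z i).2‖ ^ 2 + ‖(Φ.flow s z j).2‖ ^ 2 then
            1 + ‖(Φ.flow s z i).2‖ ^ 2 + ‖(Φ.flow s z j).2‖ ^ 2 else 0) else 0))} ≤ ENNReal.ofReal δ₁)
    (evCr : P (⋃ g : Fin (n + 1), {z | η₃ < |hsDiameter σ N / ((N : ℝ) + 1) *
      (∑ᶠ (s : ℝ) (_ : s ∈ collisionTimes (Torus.geometry (Fin 3)) (hsDiameter σ N) (fun s => Φ.flow s z) ∩
        Set.Icc 0 (t + (m + 1 : ℕ) * Δ + e)), ∑ i : Fin (N + 1), ∑ j : Fin (N + 1),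
        (if i ≠ j ∧ ‖(Torus.geometry (Fin 3)).sepVec (Φ.flow s z i).1 (Φ.flow s z j).1‖ = hsDiameter σ N then
          max 0 (min 1 (min ((s - (g : ℝ) * ((t + (m + 1 : ℕ) * Δ) / n) + ((t + (m + 1 : ℕ) * Δ) / n)) / ((t + (m + 1 : ℕ) * Δ) / n))
            (((g : ℝ) * ((t + (m + 1 : ℕ) * Δ) / n) + 2 * ((t + (m + 1 : ℕ) * Δ) / n) - s) / ((t + (m + 1 : ℕ) * Δ) / n)))) *
            max 0 (min 1 ((ηg2 - σ ^ 3 * DensityCapNegative.mollDensity r (Φ.flow s z) (Φ.flow s z i).1) / (ηg2 - ηg)))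
          else 0)) -
      σ ^ 3 * ∫ s in Set.Icc (0 : ℝ) (t + (m + 1 : ℕ) * Δ + e), ∫ x : T3,
        max 0 (min 1 (min ((s - (g : ℝ) * ((t + (m + 1 : ℕ) * Δ) / n) + ((t + (m + 1 : ℕ) * Δ) / n)) / ((t + (m + 1 : ℕ) * Δ) / n))
            (((g : ℝ) * ((t + (m + 1 : ℕ) * Δ) / n) + 2 * ((t + (m + 1 : ℕ) * Δ) / n) - s) / ((t + (m + 1 : ℕ) * Δ) / n)))) *
          max 0 (min 1 ((ηg2 - σ ^ 3 * DensityCapNegative.mollDensity r (Φ.flow s z) x) / (ηg2 - ηg))) *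
          (3 / (2 * Real.pi) * deriv hsExcessFreeEnergy (σ ^ 3 * DensityCapNegative.mollDensity r (Φ.flow s z) x)) *
          ∫ p, cone r p.1.1 x * cone r p.2.1 x * (Real.pi * ‖p.1.2 - p.2.2‖)
            ∂((empiricalMeasure (Φ.flow s z)).prod (empiricalMeasure (Φ.flow s z)))|}) ≤ ENNReal.ofReal δ₁)
    (evCr0 : P {z | η₃ < |hsDiameter σ N / ((N : ℝ) + 1) *
      (∑ᶠ (s : ℝ) (_ : s ∈ collisionTimes (Torus.geometry (Fin 3)) (hsDiameter σ N) (fun s => Φ.flow s z) ∩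
        Set.Icc 0 (t + (m + 1 : ℕ) * Δ + e)), ∑ i : Fin (N + 1), ∑ j : Fin (N + 1),
        (if i ≠ j ∧ ‖(Torus.geometry (Fin 3)).sepVec (Φ.flow s z i).1 (Φ.flow s z j).1‖ = hsDiameter σ N then
          max 0 (min 1 (min ((s - 0 + (t + (m + 1 : ℕ) * Δ)) / (t + (m + 1 : ℕ) * Δ))
            ((0 + 2 * (t + (m + 1 : ℕ) * Δ) - s) / (t + (m + 1 : ℕ) * Δ)))) *
            max 0 (min 1 ((ηg2 - σ ^ 3 * DensityCapNegative.mollDensity r (Φ.flow s z) (Φ.flow s z i).1) / (ηg2 - ηg)))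
          else 0)) -
      σ ^ 3 * ∫ s in Set.Icc (0 : ℝ) (t + (m + 1 : ℕ) * Δ + e), ∫ x : T3,
        max 0 (min 1 (min ((s - 0 + (t + (m + 1 : ℕ) * Δ)) / (t + (m + 1 : ℕ) * Δ))
            ((0 + 2 * (t + (m + 1 : ℕ) * Δ) - s) / (t + (m + 1 : ℕ) * Δ)))) *
          max 0 (min 1 ((ηg2 - σ ^ 3 * DensityCapNegative.mollDensity r (Φ.flow s z) x) / (ηg2 - ηg))) *
          (3 / (2 * Real.pi) * deriv hsExcessFreeEnergy (σ ^ 3 * DensityCapNegative.mollDensity r (Φ.flow s z) x)) *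
          ∫ p, cone r p.1.1 x * cone r p.2.1 x * (Real.pi * ‖p.1.2 - p.2.2‖)
            ∂((empiricalMeasure (Φ.flow s z)).prod (empiricalMeasure (Φ.flow s z)))|} ≤ ENNReal.ofReal δ₁)
    (evW : P (⋃ g : Fin (n + 1), {z | ηW < |∫ s in Icc 0 ((g : ℝ) * ((t + (m + 1 : ℕ) * Δ) / n)), ∫ x,
      max 0 (min 1 ((ηg2 - σ ^ 3 * rhoC r (Φ.flow s z) x) / (ηg2 - ηg))) *
      ∑ j : Fin 3, ∑ k : Fin 3, (Torus.partialDeriv k (fun y => u (max 0 (min s (t + (m + 1 : ℕ) * Δ)) + e) y j) x -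
        (if j = k then (∑ l : Fin 3, Torus.partialDeriv l (fun y => u (max 0 (min s (t + (m + 1 : ℕ) * Δ)) + e) y l) x) / 3 else 0)) *
        (Mmom r (Φ.flow s z) x j k - momC r (Φ.flow s z) x j * momC r (Φ.flow s z) x k / rhoC r (Φ.flow s z) x)|}) ≤ ENNReal.ofReal δ₁)
    (evP : P (⋃ g : Fin (n + 1), {z | ηP < |hsDiameter σ N / (N + 1 : ℝ) *
      (∑ᶠ (s : ℝ) (_ : s ∈ collisionTimes (Torus.geometry (Fin 3)) (hsDiameter σ N) (fun s => Φ.flow s z) ∩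
        Set.Icc 0 ((g : ℝ) * ((t + (m + 1 : ℕ) * Δ) / n))), ∑ i : Fin (N + 1), ∑ j : Fin (N + 1),
        (if i ≠ j ∧ ‖(Torus.geometry (Fin 3)).sepVec (Φ.flow s z i).1 (Φ.flow s z j).1‖ = hsDiameter σ N then
          max 0 (min 1 ((ηg2 - σ ^ 3 * rhoC r (Φ.flow s z) (Φ.flow s z i).1) / (ηg2 - ηg))) *
          |⟪(vin (Φ.flow s z) i j).1 - (vin (Φ.flow s z) i j).2, nrm (hsDiameter σ N) (Φ.flow s z) i j⟫_ℝ| *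
          ∑ k : Fin 3, ∑ l : Fin 3, (Torus.partialDeriv l (fun y => u (max 0 (min s (t + (m + 1 : ℕ) * Δ)) + e) y k) (Φ.flow s z i).1 +
            Torus.partialDeriv k (fun y => u (max 0 (min s (t + (m + 1 : ℕ) * Δ)) + e) y l) (Φ.flow s z i).1) / 2 *
            (nrm (hsDiameter σ N) (Φ.flow s z) i j k * nrm (hsDiameter σ N) (Φ.flow s z) i j l) else 0)) -
      2 * ∫ s in Icc 0 ((g : ℝ) * ((t + (m + 1 : ℕ) * Δ) / n)), ∫ x,
        max 0 (min 1 ((ηg2 - σ ^ 3 * rhoC r (Φ.flow s z) x) / (ηg2 - ηg))) *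
        (hsPressure σ (rhoC r (Φ.flow s z) x) (thetaC r (Φ.flow s z) x) - rhoC r (Φ.flow s z) x * thetaC r (Φ.flow s z) x) *
        ∑ k : Fin 3, (Torus.partialDeriv k (fun y => u (max 0 (min s (t + (m + 1 : ℕ) * Δ)) + e) y k) x +
          Torus.partialDeriv k (fun y => u (max 0 (min s (t + (m + 1 : ℕ) * Δ)) + e) y k) x) / 2|}) ≤ ENNReal.ofReal δ₁)
    (evL : P (⋃ g : Fin (n' + 1), {z | ηL < (∫ s in Icc 0 (t + (m + 1 : ℕ) * Δ + e), ∫ x,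
      (rhoC r (Φ.flow s z) x * max a₁ (min (3 / 2 * Real.log (thetaC r (Φ.flow s z) x) - Real.log (rhoC r (Φ.flow s z) x) -
        (hsExcessFreeEnergy (min (rhoC r (Φ.flow s z) x * σ ^ 3) η₁) +
          deriv hsExcessFreeEnergy η₁ * max (rhoC r (Φ.flow s z) x * σ ^ 3 - η₁) 0)) b₁) *
        Torus.timeDeriv (fun s' y => Real.smoothTransition ((s' + e / 2) / (e / 4)) * θ (s' + e) y *
          Real.smoothTransition (((g : ℝ) * (((t + (m + 1 : ℕ) * Δ) - Δ) / n') + Δ - s') / Δ)) s x +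
      max a₁ (min (3 / 2 * Real.log (thetaC r (Φ.flow s z) x) - Real.log (rhoC r (Φ.flow s z) x) -
        (hsExcessFreeEnergy (min (rhoC r (Φ.flow s z) x * σ ^ 3) η₁) +
          deriv hsExcessFreeEnergy η₁ * max (rhoC r (Φ.flow s z) x * σ ^ 3 - η₁) 0)) b₁) *
        ⟪momC r (Φ.flow s z) x, Torus.gradient (fun y => Real.smoothTransition ((s + e / 2) / (e / 4)) * θ (s + e) y *
          Real.smoothTransition (((g : ℝ) * (((t + (m + 1 : ℕ) * Δ) - Δ) / n') + Δ - s) / Δ)) x⟫_ℝ)) +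
      ∫ x, rhoC r (Φ.flow 0 z) x * max a₁ (min (3 / 2 * Real.log (thetaC r (Φ.flow 0 z) x) - Real.log (rhoC r (Φ.flow 0 z) x) -
        (hsExcessFreeEnergy (min (rhoC r (Φ.flow 0 z) x * σ ^ 3) η₁) +
          deriv hsExcessFreeEnergy η₁ * max (rhoC r (Φ.flow 0 z) x * σ ^ 3 - η₁) 0)) b₁) *
        (Real.smoothTransition (((0 : ℝ) + e / 2) / (e / 4)) * θ (0 + e) x *
          Real.smoothTransition (((g : ℝ) * (((t + (m + 1 : ℕ) * Δ) - Δ) / n') + Δ - 0) / Δ))}) ≤ ENNReal.ofReal δ₁)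
    (evI1 : P {z | ∃ x, δ < |rhoC r (Φ.flow 0 z) x - ρ 0 x|} ≤ ENNReal.ofReal δ₁)
    (evI2 : P {z | ∃ x, δ < ‖momC r (Φ.flow 0 z) x - ρ 0 x • u 0 x‖} ≤ ENNReal.ofReal δ₁)
    (evI3 : P {z | ∃ x, δ < |kinC r (Φ.flow 0 z) x - totalEnergyDensity (ρ 0 x) (u 0 x) (θ 0 x)|} ≤ ENNReal.ofReal δ₁) :
    P {z | thr < ∫ s in Icc t (t + (m + 1 : ℕ) * Δ),
      ((∫ x, |empiricalDensityField (Φ.flow s z) (fun y => cone r y x) - ρ s x|) +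
        (∫ x, ‖empiricalMomentumField (Φ.flow s z) (fun y => cone r y x) - ρ s x • u s x‖) +
        ∫ x, |empiricalEnergyField (Φ.flow s z) (fun y => cone r y x) - totalEnergyDensity (ρ s x) (u s x) (θ s x)|)} ≤
      ENNReal.ofReal δ' := by
  refine measure_le_of_forall_notMem12 P hδ₁ evE evCap evTail evCr evCr0 evW evP evL evI1 evI2 evI3
    (measure_compl_good_union_coincSet_eq_zero Φ hP) hδ'
    fun z nE nCap nTail nCr nCr0 nW nP nL nI1 nI2 nI3 nnull hzD => ?_
  -- off the null event: a good orbit with pairwise distinct velocities at every time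
  have ngood : z ∈ Φ.good := by_contra fun h => nnull (Set.mem_union_left _ h)
  have hdist : ∀ s : ℝ, ∀ i j : Fin (N + 1), i ≠ j → (Φ.flow s z i).2 ≠ (Φ.flow s z j).2 :=
    vel_ne_of_not_mem_coincSet Φ ngood fun h => nnull (Set.mem_union_right _ h)
  simp only [Set.mem_setOf_eq, Set.mem_iUnion, not_exists, not_lt, not_and] at nE nCap nTail nCr nCr0 nW nP nL nI1 nI2 nI3 hzD
  have hKE : ke z ≤ KE := stub_reductionFrameA Φ ngood (not_lt.2 nE)
  have key := reduction_pathwise_coldC1 hσ hσ2 Φ ngood hr hr2 hE ht0 hΔ he hT hχ hf hB0 hB hband hfband hFc hSH hδ hdist hlam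
    hlam1 hκ hη₀g0 hguard hcap0 (fun s hs x => nCap s hs x) hη₁cap hg12 hη₀gg hcapg hKE0 hKE nTail hCY0 hCY hn hne nCr nCr0 hCu
    hut hD hω hωu hωt hωD hωx0 hωx nW nP hθ hCθ hθb hθt hθx hωθ hωθt hωθx hC1 hC2 hn' nL nI1 nI2 nI3 hS2 hS3
  linarith

end Summit.AtomisticToContinuum.HydrodynamicLimit.Theorems.ChaosClosesEulerReduction

end
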